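import Summits.HubbardSuperconductivity.HubbardSuperconductivity.Theorems.AnisotropyChordTransferFibre3FamilyALemmas

/-!
# Route `AnisotropyChord` / H0 rotor rung: PartN38 — the primitive of `csc³`, `CscCubedPrimitive` PROVED

Typed target `CscCubedPrimitive` of `…Fibre3FamilyALemmas` (PORT PartN38, theory seat `hubbard-h0-rotor-theory-1` g21, memo 21
§316): on `(0, π)`, `d/dx [−½·cos x/sin²x − ½·log(1/tan(x/2))] = 1/sin³x`.
Proof: chain/quotient rules (`HasDerivAt.div`, `.pow`, `.log`, `Real.hasDerivAt_tan`) and the half-angle algebra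
`sin x = 2 sin(x/2)cos(x/2)`, `cos x = cos²(x/2) − sin²(x/2)`.
Prover seat `hubbard-h0-rotor-p1` g23; helper for stmt-HubbardSuperconductivity-19089 (`--supports`).
-/

set_option linter.dupNamespace false
set_option autoImplicit false

noncomputable section

namespace Summit.HubbardSuperconductivity.HubbardSuperconductivity.Theorems.AnisotropyChord.Transfer.Fibre3

/-- ★ **`CscCubedPrimitive` holds.** [folklore] -/
theorem cscCubedPrimitive_holds : CscCubedPrimitive := by
  intro x hx0 hxπ
  -- half-angle data
  set a : ℝ := Real.sin (x / 2) with ha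
  set b : ℝ := Real.cos (x / 2) with hb
  have ha0 : 0 < a := Real.sin_pos_of_pos_of_lt_pi (by linarith) (by linarith)
  have hb0 : 0 < b := Real.cos_pos_of_mem_Ioo ⟨by linarith, by linarith⟩
  have hab : a ^ 2 + b ^ 2 = 1 := Real.sin_sq_add_cos_sq (x / 2)
  have hS : Real.sin x = 2 * a * b := by
    rw [show x = 2 * (x / 2) by ring, Real.sin_two_mul]
  have hsin0 : Real.sin x ≠ 0 := by rw [hS]; positivity
  have htan : Real.tan (x / 2) = a / b := Real.tan_eq_sin_div_cos _
  have htan0 : Real.tan (x / 2) ≠ 0 := by rw [htan]; positivity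
  -- the pieces
  have h1 : HasDerivAt (fun x => Real.cos x / Real.sin x ^ 2)
      ((-Real.sin x * Real.sin x ^ 2 - Real.cos x * (2 * Real.sin x ^ (2 - 1) * Real.cos x)) / (Real.sin x ^ 2) ^ 2) x := by
    have hc := Real.hasDerivAt_cos x
    have hs2 := (Real.hasDerivAt_sin x).pow 2
    exact hc.div hs2 (pow_ne_zero 2 hsin0)
  have ht : HasDerivAt (fun x => Real.tan (x / 2)) (1 / Real.cos (x / 2) ^ 2 * (1 / 2)) x := by
    have h := Real.hasDerivAt_tan (x := x / 2) (ne_of_gt hb0)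
    have hid : HasDerivAt (fun x : ℝ => x / 2) (1 / 2) x := (hasDerivAt_id' x).div_const 2
    exact h.comp x hid
  have hu : HasDerivAt (fun x => 1 / Real.tan (x / 2))
      ((0 * Real.tan (x / 2) - 1 * (1 / Real.cos (x / 2) ^ 2 * (1 / 2))) / Real.tan (x / 2) ^ 2) x :=
    (hasDerivAt_const x (1 : ℝ)).div ht htan0
  have hlog : HasDerivAt (fun x => Real.log (1 / Real.tan (x / 2)))
      (((0 * Real.tan (x / 2) - 1 * (1 / Real.cos (x / 2) ^ 2 * (1 / 2))) / Real.tan (x / 2) ^ 2) / (1 / Real.tan (x / 2))) x :=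
    hu.log (by rw [one_div]; exact inv_ne_zero htan0)
  have hF := (h1.const_mul (-(1 / 2 : ℝ))).sub (hlog.const_mul (1 / 2 : ℝ))
  refine hF.congr_deriv ?_
  -- algebra: atoms `S = sin x`, `C = cos x`, `a`, `b` with `S = 2ab`, `S² + C² = 1`
  have hSC : Real.sin x ^ 2 + Real.cos x ^ 2 = 1 := Real.sin_sq_add_cos_sq x
  rw [htan]
  simp only [← hb]
  set S := Real.sin x with hSdef
  set C := Real.cos x with hCdef
  field_simp
  simp only [show (2 : ℕ) - 1 = 1 from rfl, pow_one, mul_zero, zero_mul]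
  linear_combination (2 * S ^ 2) * hSC - (S ^ 3 + 2 * S * C ^ 2 - 2 * S) * hS

end Summit.HubbardSuperconductivity.HubbardSuperconductivity.Theorems.AnisotropyChord.Transfer.Fibre3

end
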